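import Literature.NumberTheory.EllipticCurves.Kato2004.ZetaBodyTwistPairValuesTwoProofs
import Literature.NumberTheory.EllipticCurves.Kato2004.IwasawaCohomologyTwistLiftTwo
import HarnessLib

/-!
# Kato 2004, Thm. 12.5 (1) at `p = 2` for the PAIR `(z(f_W), z̃)`, `z̃` the odd-branch transport of `z(f_{W′})`, `W′ = W^{(−1)}`, in
# the finite-level eigenfunctional currency: the SAME layer eigenfunctional `w` that is non-zero on `proj_n y` takes on `proj_n ỹ` the
# value `ρ · w(proj_n y)` with `ρ` in a FINITE set `P ⊂ ℂ₂ˣ` — the full hypothesis `hw` of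
# `IwasawaH1Data.lengthAt_quotient_span_eq_of_layerFunctionals_finset` as a THEOREM modulo two linked `ZetaBody` witnesses and Rohrlich
# (THEOREMS ONLY)

Topic `NumberTheory/EllipticCurves`, sub-directory `Kato2004` (namespace = path). THEOREMS ONLY (net debt 0). Cell `bsd-2adic`
(run/shared/lean/pub/bsd-2adic/), seat `bsd-2adic-addL2x` GEN 21 (crux stmt-BirchSwinnertonDyer-19098 `AdditiveRankZeroAtTwo`, child C4″
stmt-BirchSwinnertonDyer-22618; repair-census entry R-B84 (1) = R-B83 (1), pen word RC-507: the ODD-BRANCH side of reading step T22 (b) of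
the descent sockets `AddKatoTwo.KatoDescentSocketAtTwoAdditive…`). Sequel of `IwasawaH1LayerEigenfunctionalZetaTwoProofs` (GEN 20, p745359:
the Kato-side conjuncts) whose construction is REPEATED here so that ONE functional carries both values. HONEST FRAMING: BSD is not proved by
any of this; nothing about Kato's Main Conjecture is asserted; the statement is CONDITIONAL on the two `ZetaBody` witnesses over Kato's pair
datum, on the LINK `Λ(u_* y′) = (1 ⊗ i_m)·Λ′(y′)` (all three produced by the ONE construction fact
`exists_eulerSystem_expStar_values_negOneTwistPair_two`) and on Rohrlich's finiteness for `f` at `2` in the kernel shape `hR`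
(`PSRohrlichAtLevel.rohrlich_primePow_of_isNewformOf`).

## Statement (`exists_finsets_forall_layerEigenfunctional_twistLift_two`)

Data: `W/ℚ` elliptic, `W′ = W^{(−1)}`, newforms `f`, `f′`; witnesses `ZetaBody W 2 f ι κ Λ c d a A z x`, `ZetaBody W′ 2 f′ ι κ′ Λ′ c d a′ A z′ x′`
over Kato's PAIR datum (`(c,12A) = (d,12N) = (d,12N′) = 1`, `c ≡ d ≡ 1 (mod A)` and `(mod 4)`, `c, d > 1`, `[a/A]⁻_f ≠ 0`, `[a′/A]⁺_{f′} ≠ 0`;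
`exists_katoPairDatum`); `u : T₂W′ ≃ T₂W` continuous, equivariant on the levels `k ≥ 2`, LINKED to `(Λ, Λ′)`; `K` cyclotomic with
topological generator `γ`; a pin `I`; `y` the lift of `(Cor z_{n+2,∅})_n`, `ỹ` the lift of `(Cor u_* z′_{n+2,∅})_n`
(`IwasawaH1Data.existsUnique_twistLift_of_zetaBody_two`); Rohrlich `hR` for `f`. Conclusion: finite `S, P ⊂ ℂ₂`, `0 ∉ P`, such that every
primitive EVEN `ℂ₂`-valued `χ` mod `2^m` with `χ(γ₀) − 1 ∉ S` has a layer `n` and an additive `w : H¹(ℚ_n, T₂W) → ℂ₂`, `ℤ₂`-semilinear,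
`χ(γ₀)`-eigen for `conj_γ`, `χ(γ₀)^{2^n} = 1`, `w(proj_n y) ≠ 0` AND `w(proj_n ỹ) = ρ·w(proj_n y)` for some `ρ ∈ P`.

## Argument

`w` is GEN 20's functional `Σ_b ψ(b)·J((1⊗σ_b)Λ_{n+2,∅}(res ·))` (`exists_layerEigenfunctional`); its value on `proj_n y` is
`2·ι₂(ξ)`, `ξ = Σ_b ψ_F(b)σ_b x` (lift `ψ = ψ_F ∘ ι₂`), non-zero off Rohrlich's set (`sum_character_embed_sigma_ne_zero_of_rohrlich_two`); by the
LINK and (C4) for `W′`, `Λ(u_* z′) = 1 ⊗ (i_M x′)`, so its value on `proj_n ỹ` is `2·ι₂(ξ′)`, `ξ′ = Σ_b ψ_F(b)σ_b(i_M x′)`. The pair value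
law (`embed_twistSum_mul_eq_embed_sum_mul`): `C_W·ι_M(ξ′) = C_{W′}·ι_M(ξ)` with level-independent constants. At a REFERENCE level `M₀` with a
primitive even `ψ₀` and `ξ₀ ≠ 0` this reads `ι_{M₀}(ρ₀) = C_{W′}/C_W` for `ρ₀ := ξ′₀/ξ₀ ∈ ℚ(ζ_{M₀})`, `ρ₀ ≠ 0`; at any level `M` with
`M₀ ∣ M`, through a ring map `τ : ℚ(ζ_{M₀}) → ℚ(ζ_M)` with `ι_M ∘ τ = ι_{M₀}` (`exists_ringHom_cyclotomicField_comp_eq`), `ξ′ = τ(ρ₀)·ξ`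
(`ι_M` injective). Hence `w(proj_n ỹ) = ι₂(τρ₀)·w(proj_n y)` and `ι₂(τρ₀) = e(ρ₀)` for the field embedding `e = ι₂ ∘ τ : ℚ(ζ_{M₀}) → ℂ₂` — a
root of `minpoly_ℚ(ρ₀)` in `ℂ₂`: `P` := these roots minus `0` (finite), `S := {ζ − 1 : ζ^{2^{n₀+2}} = 1}` (levels below the
reference level and Rohrlich's bound excluded).

References: K. Kato, Astérisque 295 (2004), Thm. 12.5 (1)(2) pp. 221–222, §13.8 p. 228, 13.5 (2) p. 227, Thm. 9.7, Thm. 6.6 (1)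
[Kato2004Asterisque]; D. Rohrlich, Invent. Math. 75 (1984) [RohrlichInventiones1984]; L. C. Washington, *Introduction to Cyclotomic Fields*
§13.1, Ch. 2 [Washington1997]; B. Mazur, J. Tate, J. Teitelbaum, Invent. Math. 84 (1986) §I.13 [MazurTateTeitelbaum1986Invent].
-/

set_option autoImplicit false

noncomputable section

open scoped BigOperators NumberField TensorProduct MatrixGroups
open Field IsDedekindDomain CongruenceSubgroup Polynomial
open Literature.NumberTheory.GaloisRepresentations
open Literature.NumberTheory.EllipticCurves Literature.NumberTheory.EllipticCurves.ModularForms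
open Literature.NumberTheory.EllipticCurves.Kato2004.EulerSystemValues Rat.HeightOneSpectrum

namespace Literature.NumberTheory.EllipticCurves.Kato2004

/-! ## §1 A ring map `ℚ(ζ_{M₀}) → ℚ(ζ_M)` compatible with two complex embeddings (`M₀ ∣ M`) -/

section Embeddings

set_option backward.isDefEq.respectTransparency false in
/-- **Compatible embeddings of cyclotomic fields.** For `M₀ ∣ M` and complex embeddings `ι₀ : ℚ(ζ_{M₀}) → ℂ`, `ι : ℚ(ζ_M) → ℂ` there is a ring
map `τ : ℚ(ζ_{M₀}) → ℚ(ζ_M)` with `ι ∘ τ = ι₀`: the image `ι₀(ζ_{M₀})` is an `M₀`-th root of unity of `ℂ`, hence a power of the primitive `M₀`-th root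
`ι(ζ_M^{M/M₀})`, i.e. `ι(θ)` for a primitive `M₀`-th root of unity `θ ∈ ℚ(ζ_M)`; send `ζ_{M₀} ↦ θ` (power basis of `ℚ(ζ_{M₀})`, minimal polynomial the
cyclotomic polynomial) — the two maps `ι ∘ τ`, `ι₀` then agree on the generator. [cite: Washington1997, Ch. 2 (Thm. 2.5, the Galois theory of ℚ(ζ_n))] -/
theorem exists_ringHom_cyclotomicField_comp_eq {M₀ M : ℕ} [NeZero M₀] [NeZero M] (hdvd : M₀ ∣ M)
    (ι₀ : CyclotomicField M₀ ℚ →+* ℂ) (ι : CyclotomicField M ℚ →+* ℂ) :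
    ∃ τ : CyclotomicField M₀ ℚ →+* CyclotomicField M ℚ, ∀ x, ι (τ x) = ι₀ x := by
  have hζ₀ := IsCyclotomicExtension.zeta_spec M₀ ℚ (CyclotomicField M₀ ℚ)
  have hζ := IsCyclotomicExtension.zeta_spec M ℚ (CyclotomicField M ℚ)
  set ζ₀ := IsCyclotomicExtension.zeta M₀ ℚ (CyclotomicField M₀ ℚ) with hζ₀def
  set ζ := IsCyclotomicExtension.zeta M ℚ (CyclotomicField M ℚ) with hζdef
  have hM₀ : M₀ ≠ 0 := NeZero.ne M₀
  obtain ⟨q, hq⟩ := hdvd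
  have hq0 : q ≠ 0 := fun h ↦ NeZero.ne M (by rw [hq, h, mul_zero])
  -- a primitive `M₀`-th root of unity `μ = ζ^q` in `ℚ(ζ_M)` and its image in `ℂ`
  have hμ : IsPrimitiveRoot (ζ ^ q) M₀ := by
    have h := hζ.pow_of_dvd hq0 ⟨M₀, by rw [hq, mul_comm]⟩
    have hMq : M / q = M₀ := by rw [hq, Nat.mul_div_cancel _ (Nat.pos_of_ne_zero hq0)]
    rwa [hMq] at h
  have hμC : IsPrimitiveRoot (ι (ζ ^ q)) M₀ := hμ.map_of_injective ι.injective
  -- `ι₀ ζ₀` is an `M₀`-th root of unity of `ℂ`, hence a power of `ι μ`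
  have hη : ι₀ ζ₀ ^ M₀ = 1 := by rw [← map_pow, hζ₀.pow_eq_one, map_one]
  obtain ⟨j, -, hj⟩ := hμC.eq_pow_of_pow_eq_one hη
  set θ : CyclotomicField M ℚ := (ζ ^ q) ^ j with hθdef
  have hιθ : ι θ = ι₀ ζ₀ := by rw [hθdef, map_pow, hj]
  have hθ : IsPrimitiveRoot θ M₀ :=
    IsPrimitiveRoot.of_map_of_injective (f := ι) (by rw [hιθ]; exact hζ₀.map_of_injective ι₀.injective) ι.injective
  -- `ζ₀ ↦ θ` extends to a `ℚ`-algebra map (power basis; minimal polynomial = cyclotomic polynomial)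
  let pb := hζ₀.powerBasis ℚ
  have hgen : pb.gen = ζ₀ := IsPrimitiveRoot.powerBasis_gen ℚ hζ₀
  have hmin : aeval θ (minpoly ℚ pb.gen) = 0 := by
    rw [hgen, ← cyclotomic_eq_minpoly_rat hζ₀ (Nat.pos_of_ne_zero hM₀), aeval_def, eval₂_eq_eval_map, map_cyclotomic]
    exact (isRoot_cyclotomic_iff.mpr hθ).eq_zero
  let τ : CyclotomicField M₀ ℚ →ₐ[ℚ] CyclotomicField M ℚ := pb.lift θ hmin
  have hτ : τ ζ₀ = θ := by rw [← hgen]; exact pb.lift_gen θ hmin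
  refine ⟨τ.toRingHom, fun x ↦ ?_⟩
  -- `ι ∘ τ` and `ι₀` agree on the generator, hence everywhere
  have hext : (ι.comp τ.toRingHom).toRatAlgHom = ι₀.toRatAlgHom := by
    refine pb.algHom_ext ?_
    rw [RingHom.toRatAlgHom_apply, RingHom.toRatAlgHom_apply, RingHom.comp_apply, hgen]
    change ι (τ ζ₀) = ι₀ ζ₀
    rw [hτ, hιθ]
  have := congrArg (fun g ↦ g x) hext
  simpa only [RingHom.toRatAlgHom_apply, RingHom.comp_apply] using this

end Embeddings

/-! ## §2 The assembly at `p = 2` -/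

section Assembly

variable {W : WeierstrassCurve ℚ} [W.IsElliptic] [ContinuousSMul ℤ_[2] (W.tateModule 2)]
  [Module.Free ℤ_[2] (W.tateModule 2)] [Module.Finite ℤ_[2] (W.tateModule 2)]
  [(W.quadraticTwist (-1)).IsElliptic] [ContinuousSMul ℤ_[2] ((W.quadraticTwist (-1)).tateModule 2)]
  [Module.Free ℤ_[2] ((W.quadraticTwist (-1)).tateModule 2)] [Module.Finite ℤ_[2] ((W.quadraticTwist (-1)).tateModule 2)]
  {N N' : ℕ} [NeZero N] [NeZero N']
  {f : CuspForm (Gamma0 N) 2} {f' : CuspForm (Gamma0 N') 2} {ι : (m : ℕ) → (CyclotomicField m ℚ →+* ℂ)} {κ κ' : ℝ}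
  {Λ : ∀ (k : ℕ) (r : Finset (HeightOneSpectrum (𝓞 ℚ))),
    H1 (tateRep W 2) (cycSubgroup 2 k r) →ₗ[ℤ_[2]] ℚ_[2] ⊗[ℚ] CyclotomicField (cycLevel 2 k r) ℚ}
  {Λ' : ∀ (k : ℕ) (r : Finset (HeightOneSpectrum (𝓞 ℚ))),
    H1 (tateRep (W.quadraticTwist (-1)) 2) (cycSubgroup 2 k r) →ₗ[ℤ_[2]] ℚ_[2] ⊗[ℚ] CyclotomicField (cycLevel 2 k r) ℚ}
  {c d a a' : ℤ} {A : ℕ}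
  {z : ∀ (k : ℕ) (r : (cyclotomicLevelsRat 2 (badPlaces c d A N)).Ideals),
    H1 (tateRep W 2) ((cyclotomicLevelsRat 2 (badPlaces c d A N)).level k r.1)}
  {x : ∀ (k : ℕ) (r : (cyclotomicLevelsRat 2 (badPlaces c d A N)).Ideals), CyclotomicField (cycLevel 2 k r.1) ℚ}
  {z' : ∀ (k : ℕ) (r : (cyclotomicLevelsRat 2 (badPlaces c d A N')).Ideals),
    H1 (tateRep (W.quadraticTwist (-1)) 2) ((cyclotomicLevelsRat 2 (badPlaces c d A N')).level k r.1)}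
  {x' : ∀ (k : ℕ) (r : (cyclotomicLevelsRat 2 (badPlaces c d A N')).Ideals), CyclotomicField (cycLevel 2 k r.1) ℚ}
  {K : ZpExtension ℚ 2} {γ : absoluteGaloisGroup ℚ} {I : IwasawaH1Data W 2 K γ}
  (u : (W.quadraticTwist (-1)).tateModule 2 ≃ₗ[ℤ_[2]] W.tateModule 2) (hu : Continuous u)
  (hV : ∀ k : ℕ, 2 ≤ k → ∀ (r : Finset (HeightOneSpectrum (𝓞 ℚ))) (σ : absoluteGaloisGroup ℚ),
    σ ∈ cycSubgroup 2 k r → ∀ t : (W.quadraticTwist (-1)).tateModule 2, u (σ • t) = σ • u t)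

/-- `4 ∣ 2^{n+2}`. [folklore] -/
private theorem four_dvd_cycLevel (n : ℕ) : 4 ∣ cycLevel 2 (n + 2) ∅ := by
  have hM : cycLevel 2 (n + 2) ∅ = 2 ^ (n + 2) := by simp [cycLevel]
  rw [hM, pow_add]
  exact Dvd.intro_left _ rfl

set_option backward.isDefEq.respectTransparency false in
set_option maxHeartbeats 800000 in
-- the assembly is long (two `ZetaBody` packages, GEN 20's construction, the reference level and the transport of the ratio)
/-- **Kato Thm. 12.5 (1) at `p = 2` for the pair `(y, ỹ)`, finite-level eigenfunctional form** — the hypothesis `hw` of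
`IwasawaH1Data.lengthAt_quotient_span_eq_of_layerFunctionals_finset` as a theorem. Data as in the module docstring (two `ZetaBody` witnesses over
Kato's pair datum, the identification `u` linked to `(Λ, Λ′)` on the levels `k ≥ 2`, `K` cyclotomic with topological generator `γ`, a pin
`I`, the lifts `y` of `(Cor z_{n+2,∅})_n` and `ỹ` of `(Cor u_* z′_{n+2,∅})_n`, Rohrlich `hR` for `f` at `2`). Conclusion: finite `S, P ⊂ ℂ₂` with
`0 ∉ P` such that every primitive even `ℂ₂`-valued `χ` mod `2^m` (`m > 0`) with `χ(γ₀) − 1 ∉ S` admits a layer `n` and an additive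
`w : H¹(ℚ_n, T₂W) → ℂ₂`, `ℤ₂`-semilinear, a `χ(γ₀)`-eigenfunctional for `conj_γ`, with `χ(γ₀)^{2^n} = 1`, `w(proj_n y) ≠ 0`, and
`w(proj_n ỹ) = ρ·w(proj_n y)` for some `ρ ∈ P`. [cite: Kato2004Asterisque, Thm. 12.5 (1)(2) (pp. 221–222), §13.8 (p. 228), 13.5 (2) (p. 227)]
[cite: MazurTateTeitelbaum1986Invent, §I.13] [cite: Washington1997, §13.1] -/
theorem exists_finsets_forall_layerEigenfunctional_twistLift_two (hbody : ZetaBody W 2 f ι κ Λ c d a A z x)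
    (hbody' : ZetaBody (W.quadraticTwist (-1)) 2 f' ι κ' Λ' c d a' A z' x')
    (hf : IsNewformOf W f) (hf' : IsNewformOf (W.quadraticTwist (-1)) f') (hκ : κ ≠ 0) (hκ' : κ' ≠ 0) (hA : 0 < A)
    (hc : Int.gcd c (6 * 2 * A) = 1) (hd : Int.gcd d (6 * 2 * N) = 1) (hd' : Int.gcd d (6 * 2 * N') = 1)
    (hcA : (A : ℤ) ∣ c - 1) (hdA : (A : ℤ) ∣ d - 1) (hc4 : (4 : ℤ) ∣ c - 1) (hd4 : (4 : ℤ) ∣ d - 1) (hc1 : 1 < c) (hd1 : 1 < d)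
    (ha : ratMinusSymbol f ((a : ℚ) / A) ≠ 0) (ha' : ratPlusSymbol f' ((a' : ℚ) / A) ≠ 0)
    (hlink : ∀ (k : ℕ) (hk : 2 ≤ k) (r : Finset (HeightOneSpectrum (𝓞 ℚ))) (i : CyclotomicField (cycLevel 2 k r) ℚ),
      ι (cycLevel 2 k r) i = Complex.I →
      ∀ y₁ : H1 (tateRep (W.quadraticTwist (-1)) 2) (cycSubgroup 2 k r),
        Λ k r (twistH1On W (W.quadraticTwist (-1)) u hu (hV k hk r) y₁) = ((1 : ℚ_[2]) ⊗ₜ[ℚ] i) * Λ' k r y₁)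
    (hK : K.IsCyclotomic) (hγ : K.IsTopGenerator γ)
    {y : I.H} (hy : ∀ n : ℕ, I.proj n y = levelToLayerTwo W hK (badPlaces c d A N) n
      (z (n + 2) (cyclotomicLevelsRat 2 (badPlaces c d A N)).idealOne))
    {y' : I.H} (hy' : ∀ n : ℕ, I.proj n y' = levelToLayerTwo W hK (badPlaces c d A N') n
      (twistH1On W (W.quadraticTwist (-1)) u hu
        (equivariant_level_of_cycSubgroup W (W.quadraticTwist (-1)) u hV (badPlaces c d A N') n)
        (z' (n + 2) (cyclotomicLevelsRat 2 (badPlaces c d A N')).idealOne)))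
    (hR : Set.Finite {χ : Σ m : ℕ, DirichletCharacter ℂ m |
        χ.1 ≠ 0 ∧ χ.1.primeFactors ⊆ {2} ∧ χ.2.IsPrimitive ∧
          ∃ L : ℂ → ℂ, Differentiable ℂ L ∧
            (∀ s : ℂ, 2 < s.re → L s = twistedLSeries f χ.2 s) ∧ L 1 = 0}) :
    ∃ (S P : Finset ℂ_[2]), (0 : ℂ_[2]) ∉ P ∧
      ∀ m : ℕ, 0 < m → ∀ χ : DirichletCharacter ℂ_[2] (2 ^ m), χ.IsPrimitive → χ.Even →
      (χ (cyclotomicGenerator 2 : ZMod (2 ^ m)) - 1) ∉ S →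
      ∃ (n : ℕ) (w : H1 (tateRep W 2) (K.layerSubgroup n) →+ ℂ_[2]),
        χ (cyclotomicGenerator 2 : ZMod (2 ^ m)) ^ 2 ^ n = 1 ∧
        (∀ (e : ℤ_[2]) (v : H1 (tateRep W 2) (K.layerSubgroup n)),
          w (e • v) = ((algebraMap ℚ_[2] ℂ_[2]).comp (algebraMap ℤ_[2] ℚ_[2])) e * w v) ∧
        (∀ v : H1 (tateRep W 2) (K.layerSubgroup n),
          w ((conjMap (tateRep W 2).toTopRep (K.layerSubgroup n) γ 1).hom.toLinearMap v) =
            χ (cyclotomicGenerator 2 : ZMod (2 ^ m)) * w v) ∧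
        w (I.proj n y) ≠ 0 ∧ ∃ ρ ∈ P, w (I.proj n y') = ρ * w (I.proj n y) := by
  classical
  -- the constants of the pair value law
  set CW : ℂ := (κ : ℂ) * ((ratMinusSymbol f ((a : ℚ) / A) : ℚ) : ℂ) / (plusPeriod f : ℂ) with hCW
  set CT : ℂ := -(κ' : ℂ) * ((ratPlusSymbol f' ((a' : ℚ) / A) : ℚ) : ℂ) / (minusPeriod f' : ℂ) with hCT
  have hΩ : (plusPeriod f : ℂ) ≠ 0 := by exact_mod_cast (IsNewform0.plusPeriod_pos_holds hf.1 hf.coeffField_eq_bot).ne'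
  have hΩ' : (minusPeriod f' : ℂ) ≠ 0 := by exact_mod_cast (IsNewform0.minusPeriod_pos_holds hf'.1 hf'.coeffField_eq_bot).ne'
  have hCW0 : CW ≠ 0 := by
    rw [hCW]
    exact div_ne_zero (mul_ne_zero (by exact_mod_cast hκ) (by exact_mod_cast ha)) hΩ
  have hCT0 : CT ≠ 0 := by
    rw [hCT]
    exact div_ne_zero (mul_ne_zero (neg_ne_zero.mpr (by exact_mod_cast hκ')) (by exact_mod_cast ha')) hΩ'
  -- Rohrlich's exceptional levels are bounded by some `B₀`; take `B ≥ 2`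
  obtain ⟨B₀, hB₀⟩ := (hR.image Sigma.fst).bddAbove
  set B : ℕ := max B₀ 2 with hBdef
  have hB : ∀ χ : (Σ m : ℕ, DirichletCharacter ℂ m), χ ∈ {χ : Σ m : ℕ, DirichletCharacter ℂ m |
      χ.1 ≠ 0 ∧ χ.1.primeFactors ⊆ {2} ∧ χ.2.IsPrimitive ∧
        ∃ L : ℂ → ℂ, Differentiable ℂ L ∧
          (∀ s : ℂ, 2 < s.re → L s = twistedLSeries f χ.2 s) ∧ L 1 = 0} → χ.1 ≤ B :=
    fun χ hχ ↦ (hB₀ ⟨χ, hχ, rfl⟩).trans (le_max_left _ _)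
  have hB2 : 2 ≤ B := le_max_right _ _
  /- ### the REFERENCE level `n₀ := B`, `M₀ = 2^{B+2}` -/
  have hM₀ : cycLevel 2 (B + 2) ∅ = 2 ^ (B + 2) := by simp [cycLevel]
  have hBn₀ : B < 2 ^ (B + 2) := lt_of_lt_of_le (by omega) (Nat.lt_pow_self one_lt_two).le
  have h4₀ : 4 ∣ cycLevel 2 (B + 2) ∅ := four_dvd_cycLevel B
  -- a primitive even `ℚ(ζ_{M₀})`-valued character `ψ₀`
  have hζ₀ := IsCyclotomicExtension.zeta_spec (cycLevel 2 (B + 2) ∅) ℚ (CyclotomicField (cycLevel 2 (B + 2) ∅) ℚ)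
  have hη₀ : IsPrimitiveRoot (IsCyclotomicExtension.zeta (cycLevel 2 (B + 2) ∅) ℚ
      (CyclotomicField (cycLevel 2 (B + 2) ∅) ℚ) ^ 4) (2 ^ B) := by
    have h := hζ₀.pow_of_dvd (p := 4) (by norm_num) h4₀
    have hdiv : cycLevel 2 (B + 2) ∅ / 4 = 2 ^ B := by
      rw [hM₀, pow_add, show (2 : ℕ) ^ 2 = 4 by norm_num, Nat.mul_div_cancel _ (by norm_num : 0 < 4)]
    rwa [hdiv] at h
  obtain ⟨ψ₀, hψ₀e, hψ₀p⟩ := LayerCharacterTwo.exists_even_isPrimitive (S := CyclotomicField (cycLevel 2 (B + 2) ∅) ℚ)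
    (show 1 ≤ B by omega) (M := cycLevel 2 (B + 2) ∅) hM₀ hη₀
  -- a `2`-adic embedding of `ℚ(ζ_{M₀})`; `ξ₀ ≠ 0` by GEN 20's non-vanishing
  haveI : Module.IsTorsionFree ℚ (CyclotomicField (cycLevel 2 (B + 2) ∅) ℚ) := DivisionSemiring.to_moduleIsTorsionFree
  haveI : Module.IsTorsionFree ℚ ℂ_[2] := DivisionSemiring.to_moduleIsTorsionFree
  let ι₂r : CyclotomicField (cycLevel 2 (B + 2) ∅) ℚ →+* ℂ_[2] :=
    (IsAlgClosed.lift (R := ℚ) (M := ℂ_[2]) (S := CyclotomicField (cycLevel 2 (B + 2) ∅) ℚ)).toRingHom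
  have hψ₀Ce : DirichletCharacter.Even (ψ₀.ringHomComp ι₂r) :=
    (LayerCharacterTwo.even_ringHomComp_iff ψ₀ ι₂r.injective).mpr hψ₀e
  have hψ₀Cp : DirichletCharacter.IsPrimitive (ψ₀.ringHomComp ι₂r) :=
    (LayerCharacterTwo.isPrimitive_ringHomComp_iff ψ₀ ι₂r.injective).mpr hψ₀p
  set ξ₀ : CyclotomicField (cycLevel 2 (B + 2) ∅) ℚ := ∑ b : (ZMod (cycLevel 2 (B + 2) ∅))ˣ,
    ψ₀ (b : ZMod (cycLevel 2 (B + 2) ∅)) * sigma (cycLevel 2 (B + 2) ∅) b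
      (x (B + 2) (cyclotomicLevelsRat 2 (badPlaces c d A N)).idealOne) with hξ₀def
  have hξ₀ : ξ₀ ≠ 0 := by
    intro h0
    have hne := sum_character_embed_sigma_ne_zero_of_rohrlich_two hbody hf hκ hA hc hd hcA hdA hc1 hd1 ha hB B hBn₀ ι₂r
      (ψ₀.ringHomComp ι₂r) hψ₀Ce hψ₀Cp
    apply hne
    have : ∑ b : (ZMod (cycLevel 2 (B + 2) ∅))ˣ, (ψ₀.ringHomComp ι₂r) (b : ZMod (cycLevel 2 (B + 2) ∅)) *
        ι₂r (sigma (cycLevel 2 (B + 2) ∅) b (x (B + 2) (cyclotomicLevelsRat 2 (badPlaces c d A N)).idealOne)) = ι₂r ξ₀ := by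
      rw [hξ₀def, map_sum]
      refine Finset.sum_congr rfl fun b _ ↦ ?_
      rw [map_mul, MulChar.ringHomComp_apply]
    rw [this, h0, map_zero]
  -- the twist element at the reference level and `ξ′₀`
  obtain ⟨i₀, hi₀⟩ := exists_embed_eq_I (ι (cycLevel 2 (B + 2) ∅)) h4₀
  obtain ⟨xT₀, hxT₀⟩ : ∃ t : CyclotomicField (cycLevel 2 (B + 2) ∅) ℚ,
      t = x' (B + 2) (cyclotomicLevelsRat 2 (badPlaces c d A N')).idealOne := ⟨_, rfl⟩
  set ξ₀' : CyclotomicField (cycLevel 2 (B + 2) ∅) ℚ := ∑ b : (ZMod (cycLevel 2 (B + 2) ∅))ˣ,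
    ψ₀ (b : ZMod (cycLevel 2 (B + 2) ∅)) * sigma (cycLevel 2 (B + 2) ∅) b (i₀ * xT₀) with hξ₀'def
  have hval₀ : CW * ι (cycLevel 2 (B + 2) ∅) ξ₀' = CT * ι (cycLevel 2 (B + 2) ∅) ξ₀ :=
    embed_twistSum_mul_eq_embed_sum_mul hbody hbody' hf hf' hA hc hd hd' hcA hdA hc4 hd4 B hi₀ ψ₀ hψ₀e xT₀ hxT₀
  have hξ₀' : ξ₀' ≠ 0 := by
    intro h0
    rw [h0, map_zero, mul_zero] at hval₀
    exact mul_ne_zero hCT0 ((map_ne_zero_iff _ (ι (cycLevel 2 (B + 2) ∅)).injective).mpr hξ₀) hval₀.symm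
  set ρ₀ : CyclotomicField (cycLevel 2 (B + 2) ∅) ℚ := ξ₀' / ξ₀ with hρ₀def
  have hρ₀ : ρ₀ ≠ 0 := div_ne_zero hξ₀' hξ₀
  have hιρ₀ : ι (cycLevel 2 (B + 2) ∅) ρ₀ * CW = CT := by
    have hιξ₀ : ι (cycLevel 2 (B + 2) ∅) ξ₀ ≠ 0 := (map_ne_zero_iff _ (ι (cycLevel 2 (B + 2) ∅)).injective).mpr hξ₀
    rw [hρ₀def, map_div₀]
    field_simp
    linear_combination hval₀
  -- the finite set of `2`-adic shadows of `ρ₀`: the roots of its minimal polynomial in `ℂ₂`, `0` removed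
  set P : Finset ℂ_[2] := ((minpoly ℚ ρ₀).aroots ℂ_[2]).toFinset.erase 0 with hPdef
  have hPmem : ∀ e : CyclotomicField (cycLevel 2 (B + 2) ∅) ℚ →+* ℂ_[2], e ρ₀ ∈ P := by
    intro e
    rw [hPdef, Finset.mem_erase, Multiset.mem_toFinset, mem_aroots]
    refine ⟨(map_ne_zero_iff _ e.injective).mpr hρ₀, minpoly.ne_zero_of_finite ℚ ρ₀, ?_⟩
    have h := aeval_algHom_apply e.toRatAlgHom ρ₀ (minpoly ℚ ρ₀)
    rw [minpoly.aeval, map_zero, RingHom.toRatAlgHom_apply] at h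
    exact h
  -- the exceptional set: `ζ - 1` for `ζ^{2^{B+2}} = 1`
  refine ⟨(Polynomial.nthRootsFinset (2 ^ (B + 2)) (1 : ℂ_[2])).image (fun ζ ↦ ζ - 1), P, Finset.notMem_erase _ _, ?_⟩
  intro m hm χ hχp hχe hχS
  -- `m > B + 2` (a character mod `2^m`, `m ≤ B + 2`, has `χ(γ₀)^{2^{B+2}} = 1`)
  have hmB : B + 2 < m := by
    by_contra hle
    rw [not_lt] at hle
    apply hχS
    rw [Finset.mem_image]
    refine ⟨χ (cyclotomicGenerator 2 : ZMod (2 ^ m)), ?_, rfl⟩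
    rw [Polynomial.mem_nthRootsFinset (pow_pos two_pos (B + 2))]
    haveI : NeZero (2 ^ m) := ⟨pow_ne_zero _ two_ne_zero⟩
    have hcop : Nat.Coprime (cyclotomicGenerator 2) (2 ^ m) := by
      rw [cyclotomicGenerator_two]; exact Nat.Coprime.pow_right _ (by norm_num)
    have hu' := ZMod.pow_totient (ZMod.unitOfCoprime _ hcop)
    rw [Nat.totient_prime_pow Nat.prime_two hm] at hu'
    have hdvd : 2 ^ (m - 1) * (2 - 1) ∣ 2 ^ (B + 2) := by
      rw [show (2 - 1 : ℕ) = 1 from rfl, mul_one]; exact pow_dvd_pow 2 (by omega)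
    obtain ⟨q, hq⟩ := hdvd
    rw [← ZMod.coe_unitOfCoprime _ hcop, ← map_pow, ← Units.val_pow_eq_pow_val, hq, pow_mul, hu', one_pow,
      Units.val_one, map_one]
  obtain ⟨n, rfl⟩ : ∃ n, m = n + 2 := ⟨m - 2, by omega⟩
  have hBn : B < 2 ^ (n + 2) := lt_of_lt_of_le (by omega) (Nat.lt_pow_self one_lt_two).le
  have hM : cycLevel 2 (n + 2) ∅ = 2 ^ (n + 2) := by simp [cycLevel]
  have h4 : 4 ∣ cycLevel 2 (n + 2) ∅ := four_dvd_cycLevel n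
  have hdvd : 2 ^ (n + 2) ∣ cycLevel 2 (n + 2) ∅ := ⟨1, by rw [hM, mul_one]⟩
  have hdvd₀ : cycLevel 2 (B + 2) ∅ ∣ cycLevel 2 (n + 2) ∅ := by
    rw [hM₀, hM]; exact pow_dvd_pow 2 (by omega)
  -- transport `χ` to the level `cycLevel 2 (n+2) ∅` of the witness
  set χ' : DirichletCharacter ℂ_[2] (cycLevel 2 (n + 2) ∅) := DirichletCharacter.changeLevel hdvd χ with hχ'
  have hcast : ∀ b : (ZMod (cycLevel 2 (n + 2) ∅))ˣ,
      χ' (b : ZMod (cycLevel 2 (n + 2) ∅)) = χ (ZMod.cast (b : ZMod (cycLevel 2 (n + 2) ∅)) : ZMod (2 ^ (n + 2))) := by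
    intro b
    rw [hχ', DirichletCharacter.changeLevel_eq_cast_of_dvd χ hdvd b]
  have hχ'e : χ'.Even := by
    change χ' (-1) = 1
    rw [← Units.coe_neg_one, hcast, Units.coe_neg_one, ZMod.cast_neg hdvd, ZMod.cast_one hdvd]
    exact hχe
  have hχp' : χ.conductor = 2 ^ (n + 2) := hχp
  have hχ'p : χ'.IsPrimitive := by
    rw [DirichletCharacter.isPrimitive_def, hχ', DirichletCharacter.conductor_changeLevel χ hdvd, hχp', hM]
  -- `g = 5` and `u = χ_cyc(γ)` at level `M`
  obtain ⟨g, hg⟩ := LayerCharacterTwo.exists_unit_eq_five (n := n) hM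
  have hχ'g : χ' (g : ZMod (cycLevel 2 (n + 2) ∅)) = χ (cyclotomicGenerator 2 : ZMod (2 ^ (n + 2))) := by
    rw [hcast, hg, cyclotomicGenerator_two]
    rw [show (5 : ZMod (cycLevel 2 (n + 2) ∅)) = ((5 : ℕ) : ZMod (cycLevel 2 (n + 2) ∅)) by norm_cast,
      ZMod.cast_natCast hdvd]
  have hgenu := hK.exists_eq_pow_or_eq_neg_pow_of_isTopGenerator_two hγ n hM
  obtain ⟨t, ht⟩ := hgenu g
  obtain ⟨t', -, ht'⟩ := LayerCharacterTwo.exists_eq_five_pow_or_eq_neg_five_pow hM hg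
    (modNCyclotomicCharacter ℚ (cycLevel 2 (n + 2) ∅) γ)
  have hval_g : χ' (g : ZMod (cycLevel 2 (n + 2) ∅)) =
      χ' ((modNCyclotomicCharacter ℚ (cycLevel 2 (n + 2) ∅) γ : (ZMod (cycLevel 2 (n + 2) ∅))ˣ) :
        ZMod (cycLevel 2 (n + 2) ∅)) ^ t := by
    have : χ' ((modNCyclotomicCharacter ℚ (cycLevel 2 (n + 2) ∅) γ ^ t : (ZMod (cycLevel 2 (n + 2) ∅))ˣ) :
        ZMod _) = χ' ((modNCyclotomicCharacter ℚ (cycLevel 2 (n + 2) ∅) γ : (ZMod (cycLevel 2 (n + 2) ∅))ˣ) :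
        ZMod _) ^ t := by
      rw [Units.val_pow_eq_pow_val, map_pow]
    rcases ht with h | h
    · rw [h]; exact this
    · rw [h, Units.val_neg, hχ'e.eval_neg]; exact this
  have hval_u : χ' ((modNCyclotomicCharacter ℚ (cycLevel 2 (n + 2) ∅) γ : (ZMod (cycLevel 2 (n + 2) ∅))ˣ) :
        ZMod (cycLevel 2 (n + 2) ∅)) = χ' (g : ZMod (cycLevel 2 (n + 2) ∅)) ^ t' := by
    have : χ' ((g ^ t' : (ZMod (cycLevel 2 (n + 2) ∅))ˣ) : ZMod _) = χ' (g : ZMod _) ^ t' := by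
      rw [Units.val_pow_eq_pow_val, map_pow]
    rcases ht' with h | h
    · rw [h]; exact this
    · rw [h, Units.val_neg, hχ'e.eval_neg]; exact this
  -- the finite order of `χ'`
  have hfin : ∃ o : ℕ, 0 < o ∧ χ' ^ o = 1 := by
    refine ⟨Fintype.card (ZMod (cycLevel 2 (n + 2) ∅))ˣ, Fintype.card_pos, MulChar.ext fun b ↦ ?_⟩
    rw [MulChar.pow_apply_coe, MulChar.one_apply_coe, ← map_pow, ← Units.val_pow_eq_pow_val, pow_card_eq_one,
      Units.val_one, map_one]
  obtain ⟨o, ho, hχo⟩ := hfin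
  have hgo : χ' (g : ZMod (cycLevel 2 (n + 2) ∅)) ^ o = 1 := by
    rw [← MulChar.pow_apply_coe, hχo, MulChar.one_apply_coe]
  -- `ψ := (χ'^t)⁻¹`
  set ψ : DirichletCharacter ℂ_[2] (cycLevel 2 (n + 2) ∅) := (χ' ^ t)⁻¹ with hψ
  have hψe : ψ.Even := even_inv (LayerCharacterTwo.even_pow hχ'e t)
  have hψu : ψ ((modNCyclotomicCharacter ℚ (cycLevel 2 (n + 2) ∅) γ : (ZMod (cycLevel 2 (n + 2) ∅))ˣ) :
      ZMod (cycLevel 2 (n + 2) ∅)) = (χ (cyclotomicGenerator 2 : ZMod (2 ^ (n + 2))))⁻¹ := by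
    rw [hψ, MulChar.inv_apply_eq_inv', MulChar.pow_apply_coe, ← hval_g, hχ'g]
  -- `ψ` is primitive: `ψ = χ'^{t(o-1)}` and `χ' = ψ^{t'(o-1)}`
  have hb : χ' ^ (t * (o - 1)) = ψ := by
    rw [hψ]
    refine eq_inv_of_mul_eq_one_left ?_
    rw [← pow_add, show t * (o - 1) + t = t * o by
        rw [Nat.mul_sub_one, Nat.sub_add_cancel (Nat.le_mul_of_pos_right t ho)],
      pow_mul', hχo, one_pow]
  have ha'' : ψ ^ (t' * (o - 1)) = χ' := by
    refine eq_of_even_of_apply_eq_of_forall_eq_pow_or hgenu (LayerCharacterTwo.even_pow hψe _) hχ'e ?_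
    rw [MulChar.pow_apply_coe, hψu, hval_u, hχ'g, inv_pow]
    have h1 : χ (cyclotomicGenerator 2 : ZMod (2 ^ (n + 2))) ^ (t' * (o - 1)) *
        χ (cyclotomicGenerator 2 : ZMod (2 ^ (n + 2))) ^ t' = 1 := by
      rw [← pow_add, show t' * (o - 1) + t' = t' * o by
        rw [Nat.mul_sub_one, Nat.sub_add_cancel (Nat.le_mul_of_pos_right t' ho)], pow_mul', ← hχ'g, hgo, one_pow]
    exact inv_eq_of_mul_eq_one_right h1
  have hψp : ψ.IsPrimitive := LayerCharacterTwo.isPrimitive_of_pow_eq_of_pow_eq hχ'p ha'' hb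
  -- a `2`-adic embedding of `ℚ(ζ_M)` and the functional
  haveI : Module.IsTorsionFree ℚ (CyclotomicField (cycLevel 2 (n + 2) ∅) ℚ) := DivisionSemiring.to_moduleIsTorsionFree
  let ι₂ : CyclotomicField (cycLevel 2 (n + 2) ∅) ℚ →+* ℂ_[2] :=
    (IsAlgClosed.lift (R := ℚ) (M := ℂ_[2]) (S := CyclotomicField (cycLevel 2 (n + 2) ∅) ℚ)).toRingHom
  have hle : cycSubgroup 2 (n + 2) ∅ ≤ K.layerSubgroup n := hK.cyclotomicLevelsRat_level_le_layerSubgroup_two (badPlaces c d A N) n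
  letI : Fintype (K.layerSubgroup n ⧸ (cycSubgroup 2 (n + 2) ∅).subgroupOf (K.layerSubgroup n)) := Fintype.ofFinite _
  obtain ⟨w, hw1, hw2, hw3⟩ := exists_layerEigenfunctional (W := W) (p := 2) (U := K.layerSubgroup n) (n + 2)
    hle (Λ (n + 2) ∅) (hbody.2.2.1 (n + 2) ∅) ι₂ ψ
  have hχU : ∀ σ ∈ K.layerSubgroup n,
      ψ ((modNCyclotomicCharacter ℚ (cycLevel 2 (n + 2) ∅) σ : (ZMod (cycLevel 2 (n + 2) ∅))ˣ) :
        ZMod (cycLevel 2 (n + 2) ∅)) = 1 :=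
    fun σ hσ ↦ hK.dirichletCharacter_apply_eq_one_of_mem_layerSubgroup_two n hM ψ hψe hσ
  -- lift `ψ` to `ℚ(ζ_M)`: `ψ = ψ_F ∘ ι₂`
  have hcard : Fintype.card (ZMod (cycLevel 2 (n + 2) ∅))ˣ ∣ cycLevel 2 (n + 2) ∅ := by
    rw [ZMod.card_units_eq_totient, hM, Nat.totient_prime_pow Nat.prime_two (by omega), show n + 2 - 1 = n + 1 from rfl]
    exact ⟨2, by ring⟩
  have he : ∀ b : (ZMod (cycLevel 2 (n + 2) ∅))ˣ, b ^ cycLevel 2 (n + 2) ∅ = 1 := fun b ↦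
    orderOf_dvd_iff_pow_eq_one.mp (dvd_trans (orderOf_dvd_card) hcard)
  obtain ⟨ψF, hψF⟩ := LayerCharacterTwo.exists_ringHomComp_eq (N := cycLevel 2 (n + 2) ∅) ι₂.injective
    (IsCyclotomicExtension.zeta_spec (cycLevel 2 (n + 2) ∅) ℚ (CyclotomicField (cycLevel 2 (n + 2) ∅) ℚ)) he ψ
  have hψFe : ψF.Even := by rw [← LayerCharacterTwo.even_ringHomComp_iff ψF ι₂.injective, hψF]; exact hψe
  -- the elements `ξ`, `ξ′` at the level of `χ`
  obtain ⟨iM, hiM⟩ := exists_embed_eq_I (ι (cycLevel 2 (n + 2) ∅)) h4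
  obtain ⟨xT, hxT⟩ : ∃ s : CyclotomicField (cycLevel 2 (n + 2) ∅) ℚ,
      s = x' (n + 2) (cyclotomicLevelsRat 2 (badPlaces c d A N')).idealOne := ⟨_, rfl⟩
  set ξ : CyclotomicField (cycLevel 2 (n + 2) ∅) ℚ := ∑ b : (ZMod (cycLevel 2 (n + 2) ∅))ˣ,
    ψF (b : ZMod (cycLevel 2 (n + 2) ∅)) * sigma (cycLevel 2 (n + 2) ∅) b
      (x (n + 2) (cyclotomicLevelsRat 2 (badPlaces c d A N)).idealOne) with hξdef
  set ξ' : CyclotomicField (cycLevel 2 (n + 2) ∅) ℚ := ∑ b : (ZMod (cycLevel 2 (n + 2) ∅))ˣ,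
    ψF (b : ZMod (cycLevel 2 (n + 2) ∅)) * sigma (cycLevel 2 (n + 2) ∅) b (iM * xT) with hξ'def
  -- the pair value law at this level, and the ratio `ξ′ = τ(ρ₀) · ξ`
  have hval : CW * ι (cycLevel 2 (n + 2) ∅) ξ' = CT * ι (cycLevel 2 (n + 2) ∅) ξ :=
    embed_twistSum_mul_eq_embed_sum_mul hbody hbody' hf hf' hA hc hd hd' hcA hdA hc4 hd4 n hiM ψF hψFe xT hxT
  obtain ⟨τ, hτ⟩ := exists_ringHom_cyclotomicField_comp_eq hdvd₀ (ι (cycLevel 2 (B + 2) ∅)) (ι (cycLevel 2 (n + 2) ∅))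
  have hratio : ξ' = τ ρ₀ * ξ := by
    apply (ι (cycLevel 2 (n + 2) ∅)).injective
    rw [map_mul, hτ]
    have h1 : CW * ι (cycLevel 2 (n + 2) ∅) ξ' = CW * (ι (cycLevel 2 (B + 2) ∅) ρ₀ * ι (cycLevel 2 (n + 2) ∅) ξ) := by
      rw [hval, ← hιρ₀]; ring
    exact mul_left_cancel₀ hCW0 h1
  -- the values of `w` on `proj_n y` and `proj_n ỹ`
  have hvalY := hw3 (z (n + 2) (cyclotomicLevelsRat 2 (badPlaces c d A N)).idealOne)
    (x (n + 2) (cyclotomicLevelsRat 2 (badPlaces c d A N)).idealOne)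
    (hbody.2.2.2.2.1 (n + 2) (cyclotomicLevelsRat 2 (badPlaces c d A N)).idealOne) hχU
  have hC4T : Λ' (n + 2) ∅ (z' (n + 2) (cyclotomicLevelsRat 2 (badPlaces c d A N')).idealOne) = (1 : ℚ_[2]) ⊗ₜ[ℚ] xT := by
    rw [hxT]; exact hbody'.2.2.2.2.1 (n + 2) (cyclotomicLevelsRat 2 (badPlaces c d A N')).idealOne
  have hΛT : Λ (n + 2) ∅ (twistH1On W (W.quadraticTwist (-1)) u hu (hV (n + 2) (Nat.le_add_left 2 n) ∅)
      (z' (n + 2) (cyclotomicLevelsRat 2 (badPlaces c d A N')).idealOne)) = (1 : ℚ_[2]) ⊗ₜ[ℚ] (iM * xT) := by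
    rw [hlink (n + 2) (Nat.le_add_left 2 n) ∅ iM hiM, hC4T, Algebra.TensorProduct.tmul_mul_tmul, one_mul]
  have hvalT := hw3 (twistH1On W (W.quadraticTwist (-1)) u hu (hV (n + 2) (Nat.le_add_left 2 n) ∅)
      (z' (n + 2) (cyclotomicLevelsRat 2 (badPlaces c d A N')).idealOne)) (iM * xT) hΛT hχU
  have hιξ : ι₂ ξ = ∑ b : (ZMod (cycLevel 2 (n + 2) ∅))ˣ, ψ (b : ZMod (cycLevel 2 (n + 2) ∅)) *
      ι₂ (sigma (cycLevel 2 (n + 2) ∅) b (x (n + 2) (cyclotomicLevelsRat 2 (badPlaces c d A N)).idealOne)) := by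
    rw [hξdef, map_sum]
    refine Finset.sum_congr rfl fun b _ ↦ ?_
    rw [map_mul, ← hψF, MulChar.ringHomComp_apply]
  have hιξ' : ι₂ ξ' = ∑ b : (ZMod (cycLevel 2 (n + 2) ∅))ˣ, ψ (b : ZMod (cycLevel 2 (n + 2) ∅)) *
      ι₂ (sigma (cycLevel 2 (n + 2) ∅) b (iM * xT)) := by
    rw [hξ'def, map_sum]
    refine Finset.sum_congr rfl fun b _ ↦ ?_
    rw [map_mul, ← hψF, MulChar.ringHomComp_apply]
  have hprojY : w (I.proj n y) =
      (Fintype.card (K.layerSubgroup n ⧸ (cycSubgroup 2 (n + 2) ∅).subgroupOf (K.layerSubgroup n)) : ℂ_[2]) * ι₂ ξ := by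
    rw [hy n, hιξ]
    unfold levelToLayerTwo
    exact hvalY
  have hprojT : w (I.proj n y') =
      (Fintype.card (K.layerSubgroup n ⧸ (cycSubgroup 2 (n + 2) ∅).subgroupOf (K.layerSubgroup n)) : ℂ_[2]) * ι₂ ξ' := by
    rw [hy' n, hιξ']
    unfold levelToLayerTwo
    exact hvalT
  refine ⟨n, w, ?_, hw1, fun v ↦ ?_, ?_, ι₂ (τ ρ₀), hPmem (ι₂.comp τ), ?_⟩
  · -- `χ(γ₀)^{2^n} = 1` (`5` has order `2^n` mod `2^{n+2}`)
    rw [cyclotomicGenerator_two, ← map_pow,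
      show ((5 : ℕ) : ZMod (2 ^ (n + 2))) ^ 2 ^ n = 1 by rw [Nat.cast_ofNat, ← ZMod.orderOf_five n, pow_orderOf_eq_one], map_one]
  · -- eigenvalue `ψ(u)⁻¹ = χ(γ₀)`
    rw [hw2 γ v, hψu, inv_inv]
  · -- `w(proj_n y) ≠ 0`
    rw [hprojY, hιξ]
    refine mul_ne_zero (by exact_mod_cast Fintype.card_ne_zero) ?_
    exact sum_character_embed_sigma_ne_zero_of_rohrlich_two hbody hf hκ hA hc hd hcA hdA hc1 hd1 ha hB n hBn ι₂ ψ hψe hψp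
  · -- `w(proj_n ỹ) = ι₂(τ ρ₀) · w(proj_n y)`
    rw [hprojT, hprojY, hratio, map_mul]
    ring

end Assembly

end Literature.NumberTheory.EllipticCurves.Kato2004

end
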